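import Summits.CriticalPhenomena.CardyFormulaZ2.Theses.CardyMagicRigidity
import Literature.Probability.RandomPlanarGeometry.NestingTransform

/-!
# Disproof of `NestingRigidity` — standing adversary's work file (cdisprove, stmt-CriticalPhenomena-4835)

Crux (route `CardyMagicRigidity`, rank 3):
`NestingRigidity : MagicFormulaZ2 → MagicFormulaT → LoopLimitZ2EqT` (literally, `nestingRigidity_iff`).

## Findings (index; details in the docstrings below)

* §0 SHAPE. The crux is an implication between three limit statements about two concrete lattice
  models; it is implied by the target `X = LoopLimitZ2EqT` alone (`nestingRigidity_of_loopLimitZ2EqT`)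
  and `¬ NestingRigidity ↔ MagicFormulaZ2 ∧ MagicFormulaT ∧ ¬ X` (`not_nestingRigidity_iff`): a
  refutation of the TYPED crux would have to PROVE both magic formulas and DISPROVE full-plane loop
  universality ℤ² ~ 𝕋. No junk was found in the three component statements (finprod honest at fixed
  mesh thanks to `cos_μ(0) = 1` + `∫ f = 0`; winding-number interiors; typing by orientation consistent
  on both lattices; `d_CN ≤ 1` on probability laws), so the typed crux is as safe as universality —
  it RESISTS refutation "for the wrong reason" (its conclusion is believed true), exactly as the
  route review d82cb032 said. Everything below therefore attacks the INTENDED CONTENT (C1–C3 of the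
  route: rigidity of the `μ = 1/6` nesting transform), i.e. the natural strengthenings a proof would
  pass through.
* §1 GLUE made explicit: `magicFormulaT_of_transfer` — `TransferContinuity → X → MagicFormulaZ2 →
  MagicFormulaT` (kill criterion (i) of the thesis in checkable form: a certified failure of
  `MagicFormulaT` refutes `X` given DKLM Cor. 10 and the transfer lemma).
* §2 TYPE-BLINDNESS (load-bearing analysis). The loop functional `A_f = nestingWeight f` and all its
  truncations are invariant under swapping the two types `F 0 ↔ F 1` (`nestingWeight_swap`,
  `truncNestingWeight_swap`), while `d_CN` is typed. Refuted strengthening: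
  `FatConfigTransformRigidity` (equal truncated loop functionals for ALL test functions and cut-offs,
  finitely many loops, every loop fat = positive-area interior ⇒ `d_CN ≤ ε`) is FALSE
  (`not_fatConfigTransformRigidity`; witness: one round circle filed under type 0 vs type 1).
  Consequence for provers: any proof of C3 must inject the type structure from the lattice
  (parent/child types alternate; the global type bit is a fair coin by self-duality of bond-ℤ² at
  1/2 resp. colour symmetry of site-𝕋 at 1/2) — the transform hypotheses carry NO type information.
* §3 DEGENERATE LOOPS ARE INVISIBLE. A loop with null interior has factor `cos_μ(0) = 1` for every `f`
  (`nestingFactor_pointLoop`); `d_CN` sees its trace. Refuted strengthening: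
  `UntypedConfigTransformRigidity` (`not_untypedConfigTransformRigidity`; witness: empty configuration
  vs one point loop). So "subsequential limits have no degenerate loops / trace = ∂ interior" is
  load-bearing for C3 (the planner's "positive area is not optional", now a theorem). §3b: even FAT +
  UNTYPED + FINITE is not enough — `not_fatUntypedConfigTransformRigidity` (circle traversed once vs
  twice: same trace, same interior a.e., same factors and diameters; `d ≥ r` by `udist`-stability of
  winding numbers): covering degree one / `W ∈ {0, ±1}` is load-bearing too.
* §4 LAW LEVEL. `LawTransformRigidity` (two probability laws of random configurations with identical
  nesting-transform data `HasNestingTransform P X f Λ ↔ HasNestingTransform P' X' f Λ` for all `f, Λ`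
  have `cnLawEDist = 0`) is FALSE (`not_lawTransformRigidity`, Dirac laws on the §2 witness;
  `one_le_cnLawEDist_const`: deterministic `d_CN`-far configurations are at coupling distance `≥ 1`).
* §5 CONDITIONAL COUNTEREXAMPLE TO CONTINUUM INJECTIVITY WITHOUT NON-CROSSING (new, not in the route
  text): by SSW's theorem (arXiv:math/0611687, Thm 1 / (mgf), read from the held text p. 3) the
  log-conformal-radius decrement of nested CLE_κ loops has MGF `−cos(4π/κ)/cos(π√((1−4/κ)²+8λ/κ))`;
  for the dense/dilute pair `1/κ + 1/κ' = 1/2` the three κ-dependences coincide up to `λ ↦ (κ/κ')λ`,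
  so `B₃ = 2·B₆` in law (`sswMGF_three_eq_six`). Hence EVERY one-point twisted nesting exponent of CLE₃
  is exactly half that of CLE₆, and with the magic twist `μ = 1/6` (natural for both: `n = −2cos(4π/κ)
  = 1` iff `κ ∈ {3, 6}`) the two-point Gaussian exponents are `σ² = κ/2π`: `3/π` for CLE₆ (DKLM) and
  `3/2π` for CLE₃ (`magicExponent_six`, `magicExponent_three`, `two_point_*`; the κ-proportionality of
  the whole MWW nesting spectrum at fixed `n` is visible in the parametric form printed in
  Borot–Bouttier–Duplantier arXiv:1605.02239 §9.3.4, p. 27 of the held text). Transforms MULTIPLY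
  under independent superposition (`nestingWeight_union` at configuration level; at LAW level
  `truncNestingTransform_prod`, `hasNestingTransform_union`, `superposition_half_variance`, §5b: two
  independent ensembles with transform `exp((3/8π²)Q)` superpose to one with `exp((3/4π²)Q)`). So IF the twisted
  nesting field of full-plane CLE₃ is the free field with `σ² = 3/2π` (the dilute-O(1)/Ising analogue
  of `MagicFormulaT`, same Coulomb-gas status, g = 4/3), THEN the union of two independent full-plane
  CLE₃'s has EXACTLY the CLE₆ magic transform `exp((3/4π²)∬ log|x−y| f f)` while being E(2)-invariant,
  mixing, locally finite, with simple fat loops — and d_CN-far from CLE₆. Any injectivity class for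
  C3 must therefore contain NON-CROSSING / nesting-tree (percolation) structure; "E(2)-invariant,
  ergodic, positive-area interiors" (the class named in the item) is NOT enough (conditionally), and
  the transform is blind even to the Hausdorff dimension of the loops (7/4 vs 11/8). Printed context:
  Miller–Watson–Wilson, PTRF 163 (2015) §8, Question "deterministic" (held text p. 16): for κ ∈ (4,8)
  the CLE is NOT expected to be a pathwise function of its (weighted) nesting field — a sample-level
  caveat; the crux needs the (different, open) LAW-level injectivity, for which nothing is in print
  (grounders g20-19/g22-5 concur).
* §6 MONTE CARLO (route's cheapest falsifier, kit): see `-- MC` comment block (job ids, numbers) —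
  filled in as jobs return.
* §7 NEAR-MISSES (this file only): the POSITIVE
  statement `finiteConfig_transform_injective` (grading argument: for finitely supported laws on
  finite configurations of Jordan loops the transform IS injective up to types — why cheap
  finite counterexamples to C3 do not exist; the obstruction to C3 is infinite nesting = unbounded
  total variation of the complex height measure, cf. review d82cb032).

LANDED (p68977, ACCEPTED 2026-08-15T22:49Z, commit 332a990b6ca9): the sorry-free content of §2–§5b is in the
tree as the barrier-catalogue entry `Literature/Barriers/CriticalPhenomena/NestingTransformBlindness.lean`
(`Literature.Barriers.CriticalPhenomena.NestingTransformBlindness`, proved `nestingTransformBlindness_holds`;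
witness namespace `Literature.Barriers.CriticalPhenomena.NestingBlind`: `windLoop`, `single`, `swap`, `untype`,
`union`, `truncNestingTransform_prod`, `hasNestingTransform_union`, `superposition_half_variance`, `sswMGF`,
`sswMGF_dilute_eq_dense`, `magicExponent`, …) — planners/ideators/provers: `import
Literature.Barriers.CriticalPhenomena.NestingTransformBlindness`. (Refuters cannot land non-`¬` files under
`Theorems/`, and `Theorems/` is flat, so there is no `Theorems/NestingRigidity/Negative/`.)
-/

noncomputable section

namespace Summit.CriticalPhenomena.CardyFormulaZ2.Cruxes.NestingRigidity.Disproof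

open Literature.Probability.RandomPlanarGeometry
open Summit.CriticalPhenomena.CardyFormulaZ2.Theses.CardyMagicRigidity
open MeasureTheory Set Filter
open scoped Real Topology ENNReal

/-! ## §0 Shape of the crux -/

/-- The crux is literally `MagicFormulaZ2 → MagicFormulaT → LoopLimitZ2EqT`. [folklore] -/
theorem nestingRigidity_iff :
    NestingRigidity ↔ (MagicFormulaZ2 → MagicFormulaT → LoopLimitZ2EqT) := Iff.rfl

/-- The target alone implies the crux (so, as a `Prop`, the crux is weaker than rank 0). [folklore] -/
theorem nestingRigidity_of_loopLimitZ2EqT (hX : LoopLimitZ2EqT) : NestingRigidity := fun _ _ ↦ hX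

/-- What a refutation of the typed crux costs: BOTH magic formulas and the failure of full-plane
loop universality ℤ² ~ 𝕋. [folklore] -/
theorem not_nestingRigidity_iff :
    ¬ NestingRigidity ↔ (MagicFormulaZ2 ∧ MagicFormulaT ∧ ¬ LoopLimitZ2EqT) := by
  rw [nestingRigidity_iff, Classical.not_imp, Classical.not_imp]

/-! ## §1 Glue: `MagicFormulaT` is necessary for `X` given DKLM and the transfer lemma -/

/-- Kill criterion (i) of the thesis, formally: `TransferContinuity → X → MagicFormulaZ2 → MagicFormulaT`
(`Λ^𝕋_δ = Λ^ℤ²_δ − (Λ^ℤ²_δ − Λ^𝕋_δ) → G(f) − 0`). Contrapositive: a certified deviation of the site-𝕋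
transform from the Gaussian refutes loop universality ℤ² ~ 𝕋, given DKLM Cor. 10 and the transfer
lemma. [folklore] -/
theorem magicFormulaT_of_transfer (hTC : TransferContinuity) (hX : LoopLimitZ2EqT)
    (h2 : MagicFormulaZ2) : MagicFormulaT := by
  intro f R C hf hC hR h0
  have hZ := h2 f R C hf hC hR h0
  have hD := hTC hX f R C hf hC hR h0
  have key := hZ.sub hD
  simp only [sub_sub_cancel, sub_zero] at key
  exact key

/-! ## §2–§3 Witness loops and configurations -/

/-- The constant (point) loop at `x`: a degenerate loop with null (empty) interior. [folklore] -/
def pointLoop (x : ℂ) : UnbasedLoop ℂ :=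
  UnbasedLoop.mk (BasedLoop.mk (CurveClass.mk (Curve.const x)) (CurveClass.isLoop_mk.2 rfl))

/-- The trace of the point loop is `{x}`. [folklore] -/
@[simp] theorem range_pointLoop (x : ℂ) : (pointLoop x).range = {x} := by
  simp [pointLoop, Curve.range]

/-- The point loop winds around nothing. [folklore] -/
@[simp] theorem wind_pointLoop (x z : ℂ) : (pointLoop x).wind z = 0 := by
  show (Curve.const x).wind z = 0
  by_cases hz : z = x
  · subst hz
    exact Curve.wind_of_mem_range ⟨0, rfl⟩
  · refine Curve.wind_eq_zero_of_subset_ball (w := x) (ρ := dist z x) ?_ le_rfl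
    rintro _ ⟨t, rfl⟩
    simpa [Curve.const_apply] using dist_pos.2 hz

/-- The interior `{W ≠ 0}` of the point loop is empty, so its `f`-mass vanishes. [folklore] -/
@[simp] theorem nestingPhase_pointLoop (f : ℂ → ℝ) (x : ℂ) : (pointLoop x).nestingPhase f = 0 := by
  rw [UnbasedLoop.nestingPhase]
  have : {z : ℂ | (pointLoop x).wind z ≠ 0} = ∅ := by
    ext z; simp
  rw [this, Measure.restrict_empty, integral_zero_measure]

/-- **Degenerate loops are invisible to the transform**: the point loop has factor `cos_μ(0) = 1` for
every test function. [folklore] -/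
@[simp] theorem nestingFactor_pointLoop (f : ℂ → ℝ) (x : ℂ) : (pointLoop x).nestingFactor f = 1 :=
  UnbasedLoop.nestingFactor_eq_one_of_nestingPhase_eq_zero (nestingPhase_pointLoop f x)

/-- The round circle `t ↦ c + r e^{2πit}`. [folklore] -/
def circleCurve (c : ℂ) (r : ℝ) : Curve ℂ :=
  ⟨⟨fun t : unitInterval ↦ c + r * Complex.exp (2 * π * Complex.I * (t : ℝ)), by fun_prop⟩⟩

/-- Pointwise formula for the circle. [folklore] -/
theorem circleCurve_apply (c : ℂ) (r : ℝ) (t : unitInterval) :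
    circleCurve c r t = c + r * Complex.exp (2 * π * Complex.I * (t : ℝ)) := rfl

/-- The circle is a closed curve (`e^{2πi} = 1`). [folklore] -/
theorem isLoop_circleCurve (c : ℂ) (r : ℝ) : (circleCurve c r).IsLoop := by
  rw [Curve.isLoop_iff, Curve.source_def, Curve.target_def, circleCurve_apply, circleCurve_apply]
  simp [Complex.exp_two_pi_mul_I]

/-- The round circle of radius `r` about `c` as an unbased loop. [folklore] -/
def circleLoop (c : ℂ) (r : ℝ) : UnbasedLoop ℂ :=
  UnbasedLoop.mk (BasedLoop.mk (CurveClass.mk (circleCurve c r)) (CurveClass.isLoop_mk.2 (isLoop_circleCurve c r)))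

/-- The trace of the circle lies in the closed ball of radius `|r|`. [folklore] -/
theorem range_circleLoop_subset (c : ℂ) (r : ℝ) :
    (circleLoop c r).range ⊆ Metric.closedBall c |r| := by
  rintro _ ⟨t, rfl⟩
  rw [Metric.mem_closedBall, Complex.dist_eq]
  show ‖circleCurve c r t - c‖ ≤ |r|
  rw [circleCurve_apply, add_sub_cancel_left, norm_mul, Complex.norm_real, Real.norm_eq_abs,
    show (2 * π * Complex.I * (t : ℝ) : ℂ) = ((2 * π * (t : ℝ) : ℝ) : ℂ) * Complex.I by push_cast; ring,
    Complex.norm_exp_ofReal_mul_I, mul_one]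

/-- **The circle is fat**: it winds once around its centre (explicit logarithm `log r + 2πit`). [folklore] -/
theorem wind_circleLoop_center (c : ℂ) {r : ℝ} (hr : 0 < r) : (circleLoop c r).wind c = 1 := by
  show (circleCurve c r).wind c = ((1 : ℤ) : ℤ)
  refine Curve.wind_eq_of_log (isLoop_circleCurve c r) (l := fun t ↦ (Real.log r : ℂ) + 2 * π * Complex.I * t)
    (by fun_prop) (fun t ht ↦ ?_) ?_
  · rw [Complex.exp_add, ← Complex.ofReal_exp, Real.exp_log hr]
    show (r : ℂ) * Complex.exp (2 * π * Complex.I * t) = circleCurve c r ⟨t, ht⟩ - c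
    rw [circleCurve_apply, add_sub_cancel_left]
  · push_cast; ring

/-- A loop is **fat** if it winds around some point (its interior `{W ≠ 0}` is a non-empty open set,
hence of positive area). [folklore] -/
def Fat (u : UnbasedLoop ℂ) : Prop := ∃ z, u.wind z ≠ 0

/-- The round circle is fat. [folklore] -/
theorem fat_circleLoop (c : ℂ) {r : ℝ} (hr : 0 < r) : Fat (circleLoop c r) :=
  ⟨c, by rw [wind_circleLoop_center c hr]; exact one_ne_zero⟩

/-- The point loop is not fat. [folklore] -/
theorem not_fat_pointLoop (x : ℂ) : ¬ Fat (pointLoop x) := by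
  rintro ⟨z, hz⟩; exact hz (wind_pointLoop x z)

/-- The empty configuration. [folklore] -/
def emptyConfig : LoopConfig ℂ := ⟨fun _ ↦ ∅⟩

/-- One loop `u`, filed under type `i`. [folklore] -/
def single (i : Fin 2) (u : UnbasedLoop ℂ) : LoopConfig ℂ := ⟨fun j ↦ if j = i then {u} else ∅⟩

/-- **Type swap** `F 0 ↔ F 1`. [folklore] -/
def swap (c : LoopConfig ℂ) : LoopConfig ℂ := ⟨![c.F 1, c.F 0]⟩

/-- The empty configuration has no loops. [folklore] -/
@[simp] theorem loops_emptyConfig : emptyConfig.loops = ∅ := by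
  simp [emptyConfig, LoopConfig.loops]

/-- The loops of `single i u` are `{u}`. [folklore] -/
@[simp] theorem loops_single (i : Fin 2) (u : UnbasedLoop ℂ) : (single i u).loops = {u} := by
  ext v
  fin_cases i <;> simp [single, LoopConfig.mem_loops_iff]

/-- `u` is filed under type `i` in `single i u`. [folklore] -/
theorem mem_single_self (i : Fin 2) (u : UnbasedLoop ℂ) : u ∈ (single i u).F i := by
  simp [single]

/-- Type swap does not change the set of all loops. [folklore] -/
@[simp] theorem loops_swap (c : LoopConfig ℂ) : (swap c).loops = c.loops := by
  ext v
  simp [swap, LoopConfig.mem_loops_iff, or_comm]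

/-- Type swap does not change the big loops. [folklore] -/
@[simp] theorem bigLoops_swap (ε : ℝ) (c : LoopConfig ℂ) : (swap c).bigLoops ε = c.bigLoops ε := by
  simp [LoopConfig.bigLoops]

/-- **The loop functional is type-blind.** [folklore] -/
@[simp] theorem nestingWeight_swap (f : ℂ → ℝ) (c : LoopConfig ℂ) :
    (swap c).nestingWeight f = c.nestingWeight f := by
  rw [LoopConfig.nestingWeight, LoopConfig.nestingWeight, loops_swap]

/-- **Every truncation of the loop functional is type-blind.** [folklore] -/
@[simp] theorem truncNestingWeight_swap (f : ℂ → ℝ) (ε : ℝ) (c : LoopConfig ℂ) :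
    (swap c).truncNestingWeight f ε = c.truncNestingWeight f ε := by
  rw [LoopConfig.truncNestingWeight, LoopConfig.truncNestingWeight, bigLoops_swap]

/-- Swapping the types of `single 0 u` gives `single 1 u`. [folklore] -/
theorem swap_single_zero (u : UnbasedLoop ℂ) : swap (single 0 u) = single 1 u := by
  ext i v
  fin_cases i <;> simp [swap, single]

/-- The truncated loop functional of `single i u` does not depend on the type `i`. [folklore] -/
theorem truncNestingWeight_single_eq (f : ℂ → ℝ) (ε : ℝ) (i j : Fin 2) (u : UnbasedLoop ℂ) :
    (single i u).truncNestingWeight f ε = (single j u).truncNestingWeight f ε := by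
  simp only [LoopConfig.truncNestingWeight, LoopConfig.bigLoops, loops_single]

/-- The configuration consisting of one point loop has ALL truncated loop functionals equal to `1`,
like the empty configuration. [folklore] -/
theorem truncNestingWeight_single_pointLoop (f : ℂ → ℝ) (ε : ℝ) (i : Fin 2) (x : ℂ) :
    (single i (pointLoop x)).truncNestingWeight f ε = 1 := by
  rw [LoopConfig.truncNestingWeight]
  refine finprod_mem_of_eqOn_one fun u hu ↦ ?_
  have hu' : u ∈ (single i (pointLoop x)).loops := LoopConfig.bigLoops_subset_loops _ _ hu
  rw [loops_single, mem_singleton_iff] at hu'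
  subst hu'
  exact nestingFactor_pointLoop f x

/-- The empty configuration has all truncated loop functionals equal to `1`. [folklore] -/
theorem truncNestingWeight_emptyConfig (f : ℂ → ℝ) (ε : ℝ) : emptyConfig.truncNestingWeight f ε = 1 :=
  LoopConfig.truncNestingWeight_empty f ε

/-- Type swap is `d_CN`-visible: a loop inside the window filed under type `0` on one side and type `1`
on the other has no partner of its own type. [folklore] -/
theorem not_isClose_single_swap {ε : ℝ} (u : UnbasedLoop ℂ)
    (hu : u.range ⊆ Metric.ball (0 : ℂ) (1 / ε)) : ¬ LoopConfig.IsClose ε (single 0 u) (single 1 u) := by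
  intro h
  obtain ⟨u', hu', -⟩ := (h 0).1 u (mem_single_self 0 u) hu
  simp [single] at hu'

/-- A degenerate loop is `d_CN`-visible: a point loop inside the window has no partner in the empty
configuration. [folklore] -/
theorem not_isClose_single_pointLoop_empty {ε : ℝ} (hε : 0 < ε) (i : Fin 2) :
    ¬ LoopConfig.IsClose ε (single i (pointLoop 0)) emptyConfig := by
  intro h
  obtain ⟨u', hu', -⟩ := (h i).1 (pointLoop 0) (mem_single_self i _)
    (by rw [range_pointLoop, singleton_subset_iff]; exact Metric.mem_ball_self (by positivity))
  exact hu'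

/-! ## §2 Refuted strengthening: transform data do not see types (fat loops, finitely many) -/

/-- **(S-fat) Configuration-level transform rigidity for finite configurations of fat loops**: if two
typed configurations with finitely many loops, all fat (positive-area interiors), have the same
truncated loop functional `A^ε_f` for EVERY test function `f : ℂ → ℝ` and EVERY cut-off `ε`, then they
are `d_CN`-close at every scale `ε ∈ (0, 1]`. This is the configuration-level shadow of "the `μ = 1/6`
nesting transform determines the (typed) loop configuration" with the non-degeneracy side condition
already imposed. FALSE: `not_fatConfigTransformRigidity`. [folklore] -/
def FatConfigTransformRigidity : Prop :=
  ∀ c c' : LoopConfig ℂ, c.loops.Finite → c'.loops.Finite →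
    (∀ u ∈ c.loops, Fat u) → (∀ u ∈ c'.loops, Fat u) →
    (∀ (f : ℂ → ℝ) (ε : ℝ), c.truncNestingWeight f ε = c'.truncNestingWeight f ε) →
    ∀ ε : ℝ, 0 < ε → ε ≤ 1 → LoopConfig.IsClose ε c c'

/-- **Types are invisible to the transform**: the circle of radius `1/2` about `0` filed under type `0`,
versus the same circle filed under type `1`, have identical truncated loop functionals for all `f, ε`
but are not `d_CN`-close at any scale `ε ≤ 1`. Hence any proof of `NestingRigidity` through
injectivity of the transform must supply the typing from the lattice structure (types alternate
along the nesting tree; the global bit is symmetric), not from the hypotheses `MagicFormulaZ2`,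
`MagicFormulaT`. [folklore] -/
theorem not_fatConfigTransformRigidity : ¬ FatConfigTransformRigidity := by
  intro h
  set u : UnbasedLoop ℂ := circleLoop 0 (1 / 2) with hu
  have hfat : Fat u := fat_circleLoop 0 (by norm_num)
  have hball : u.range ⊆ Metric.ball (0 : ℂ) (1 / 1) := by
    refine (range_circleLoop_subset 0 (1 / 2)).trans ?_
    intro z hz
    rw [Metric.mem_closedBall] at hz
    rw [Metric.mem_ball]
    have : |(1 / 2 : ℝ)| = 1 / 2 := abs_of_pos (by norm_num)
    linarith
  refine not_isClose_single_swap u hball (h (single 0 u) (single 1 u) ?_ ?_ ?_ ?_ ?_ 1 one_pos le_rfl)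
  · rw [loops_single]; exact finite_singleton u
  · rw [loops_single]; exact finite_singleton u
  · intro v hv; rw [loops_single, mem_singleton_iff] at hv; exact hv ▸ hfat
  · intro v hv; rw [loops_single, mem_singleton_iff] at hv; exact hv ▸ hfat
  · intro f ε; exact truncNestingWeight_single_eq f ε 0 1 u

/-! ## §3 Refuted strengthening: transform data do not see degenerate loops (untyped comparison) -/

/-- Forget the types: all loops in both families (so that `IsClose` compares loops regardless of
type). [folklore] -/
def untype (c : LoopConfig ℂ) : LoopConfig ℂ := ⟨fun _ ↦ c.loops⟩

/-- Both families of `untype c` are all loops of `c`. [folklore] -/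
@[simp] theorem untype_F (c : LoopConfig ℂ) (i : Fin 2) : (untype c).F i = c.loops := rfl

/-- **(S-untyped) Untyped configuration-level transform rigidity for finite configurations**: equal
truncated loop functionals for all `f, ε` ⇒ the UNTYPED configurations are `d_CN`-close at every scale
`ε ∈ (0,1]`. Type swap does not refute this one; degenerate loops do: `not_untypedConfigTransformRigidity`.
[folklore] -/
def UntypedConfigTransformRigidity : Prop :=
  ∀ c c' : LoopConfig ℂ, c.loops.Finite → c'.loops.Finite →
    (∀ (f : ℂ → ℝ) (ε : ℝ), c.truncNestingWeight f ε = c'.truncNestingWeight f ε) →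
    ∀ ε : ℝ, 0 < ε → ε ≤ 1 → LoopConfig.IsClose ε (untype c) (untype c')

/-- **Degenerate loops are invisible to the transform but not to `d_CN`**: the empty configuration and
the configuration with one point loop at the origin have all truncated loop functionals equal (to `1`)
and are `d_CN`-far. Hence "subsequential limits carry no loops with null interior" (more precisely:
trace `⊆` closure of the interior's boundary) is load-bearing for C3 — an RSW input on the lattice
side, not a consequence of the transform hypotheses. [folklore] -/
theorem not_untypedConfigTransformRigidity : ¬ UntypedConfigTransformRigidity := by
  intro h
  have hc := h (single 1 (pointLoop 0)) emptyConfig (by rw [loops_single]; exact finite_singleton _)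
    (by rw [loops_emptyConfig]; exact finite_empty)
    (fun f ε ↦ by rw [truncNestingWeight_single_pointLoop, truncNestingWeight_emptyConfig]) 1 one_pos le_rfl
  obtain ⟨u', hu', -⟩ := (hc 0).1 (pointLoop 0) (by simp [untype])
    (by rw [range_pointLoop, singleton_subset_iff]; exact Metric.mem_ball_self (by norm_num))
  simp [untype] at hu'

/-! ## §4 Law level: identical nesting-transform data, coupling distance `≥ 1` -/

section Law

variable {Ω Ω' : Type*} [MeasurableSpace Ω] [MeasurableSpace Ω']

/-- The truncated transform of a deterministic configuration under a probability law is its truncated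
loop functional. [folklore] -/
theorem truncNestingTransform_const (P : Measure Ω) [IsProbabilityMeasure P] (c : LoopConfig ℂ)
    (f : ℂ → ℝ) : truncNestingTransform P (fun _ ↦ c) f = fun ε ↦ c.truncNestingWeight f ε := by
  funext ε
  simp [truncNestingTransform]

/-- **Deterministic `d_CN`-far configurations are at coupling distance `≥ 1`** (every coupling charges
the sure event). [folklore] -/
theorem one_le_cnLawEDist_const (P : Measure Ω) (P' : Measure Ω') [IsProbabilityMeasure P]
    {c c' : LoopConfig ℂ} (h : ∀ ε : ℝ, 0 < ε → ε ≤ 1 → ¬ LoopConfig.IsClose ε c c') :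
    1 ≤ LoopConfig.cnLawEDist P (fun _ ↦ c) P' (fun _ ↦ c') := by
  simp only [LoopConfig.cnLawEDist, le_iInf_iff]
  intro ε hε Q h1 _h2 hQ
  by_cases hε1 : ε ≤ 1
  · exfalso
    have huniv : {p : Ω × Ω' | ¬ LoopConfig.IsClose ε c c'} = univ :=
      eq_univ_of_forall fun _ ↦ h ε hε hε1
    rw [huniv] at hQ
    have hQ1 : Q univ = 1 := by
      have := congrArg (fun ν : Measure Ω ↦ ν univ) h1
      simpa [Measure.map_apply measurable_fst MeasurableSet.univ] using this
    rw [hQ1] at hQ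
    exact absurd (hQ.trans_le (ENNReal.ofReal_le_one.2 hε1)) (lt_irrefl 1)
  · calc (1 : ℝ≥0∞) = ENNReal.ofReal 1 := ENNReal.ofReal_one.symm
      _ ≤ ENNReal.ofReal ε := ENNReal.ofReal_le_ofReal (not_le.1 hε1).le

end Law

/-- **(S-law) Law-level transform rigidity**: two probability laws of random typed loop configurations
with identical nesting-transform data (same limits `Λ^ε → Λ` of the truncated transforms, for every test
function) are at coupling distance `0`. The law-level shadow of C3 with no side condition. FALSE:
`not_lawTransformRigidity` (and it stays false with fat loops only, by the §2 witness used here).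
[folklore] -/
def LawTransformRigidity : Prop :=
  ∀ (Ω Ω' : Type) [MeasurableSpace Ω] [MeasurableSpace Ω'] (P : Measure Ω) (P' : Measure Ω')
    [IsProbabilityMeasure P] [IsProbabilityMeasure P'] (X : Ω → LoopConfig ℂ) (X' : Ω' → LoopConfig ℂ),
    (∀ (f : ℂ → ℝ) (Λ : ℝ), HasNestingTransform P X f Λ ↔ HasNestingTransform P' X' f Λ) →
    LoopConfig.cnLawEDist P X P' X' = 0

theorem not_lawTransformRigidity : ¬ LawTransformRigidity := by
  intro h
  set u : UnbasedLoop ℂ := circleLoop 0 (1 / 2) with hu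
  have hball : ∀ ε : ℝ, 0 < ε → ε ≤ 1 → u.range ⊆ Metric.ball (0 : ℂ) (1 / ε) := by
    intro ε hε hε1 z hz
    have hz' := range_circleLoop_subset 0 (1 / 2) hz
    rw [Metric.mem_closedBall, abs_of_pos (by norm_num : (0 : ℝ) < 1 / 2)] at hz'
    rw [Metric.mem_ball]
    have : (1 : ℝ) ≤ 1 / ε := by rw [le_div_iff₀ hε]; linarith
    linarith
  have h0 := h Unit Unit (Measure.dirac ()) (Measure.dirac ()) (fun _ ↦ single 0 u) (fun _ ↦ single 1 u)
    (fun f Λ ↦ by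
      simp only [HasNestingTransform, truncNestingTransform_const]
      rw [funext fun ε ↦ truncNestingWeight_single_eq f ε 0 1 u])
  have h1 := one_le_cnLawEDist_const (Measure.dirac ()) (Measure.dirac ()) (c := single 0 u)
    (c' := single 1 u) (fun ε hε hε1 ↦ not_isClose_single_swap u (hball ε hε hε1))
  rw [h0] at h1
  exact absurd h1 (by simp)

/-! ## §5 Conditional counterexample to continuum injectivity without non-crossing: CLE₃ ⊔ CLE₃ vs CLE₆ -/

/-- **SSW's moment generating function** of the log-conformal-radius decrement `B_κ` between successive
nested CLE_κ loops around a point (Schramm–Sheffield–Wilson, CMP 288 (2009), arXiv:math/0611687,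
Theorem 1 and display (mgf), p. 3 of the held text: `E[exp(λ B_κ)] = −cos(4π/κ)/cos(π√((1−4/κ)² +
8λ/κ))` for `Re λ < 1 − 2/κ − 3κ/32`, `8/3 < κ < 8`). Transcribed as a real function of `(κ, λ)`.
[cite: SchrammSheffieldWilson2009, Thm 1] -/
def sswMGF (κ l : ℝ) : ℝ :=
  -Real.cos (4 * π / κ) / Real.cos (π * Real.sqrt ((1 - 4 / κ) ^ 2 + 8 * l / κ))

/-- **Dense–dilute duality of CLE nesting (κ = 6 vs κ' = 3, `1/κ + 1/κ' = 1/2`)**: `E[e^{λ B₃}] =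
E[e^{2λ B₆}]` identically, i.e. `B₃ = 2 B₆` in law: the nested CLE₃ loops around a point are, in
log-conformal radius, exactly twice as sparse as CLE₆'s with the same shape. Hence every one-point
nesting exponent of CLE₃ (for every loop weight `w`) is half that of CLE₆, and the superposition of two
independent CLE₃'s reproduces ALL one-point twisted nesting exponents of CLE₆ — including the linear
(background-charge) terms of the `μ = 1/6` twist. [folklore] -/
theorem sswMGF_three_eq_six (l : ℝ) : sswMGF 3 l = sswMGF 6 (2 * l) := by
  unfold sswMGF
  have h1 : Real.cos (4 * π / 3) = Real.cos (4 * π / 6) := by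
    rw [show 4 * π / 3 = 2 * π - 2 * π / 3 by ring, Real.cos_two_pi_sub]
    congr 1; ring
  have h2 : (1 - 4 / 3 : ℝ) ^ 2 + 8 * l / 3 = (1 - 4 / 6) ^ 2 + 8 * (2 * l) / 6 := by ring
  rw [h1, h2]

/-- **General dense–dilute duality of SSW's law**: for `1/κ + 1/κ' = 1/2` (same loop weight
`n = −2cos(4π/κ) = −2cos(4π/κ')`, dense `κ ∈ [4,8)` vs dilute `κ' ∈ (8/3,4]`: `(6,3)`, `(16/3, 16/5)`,
`(8, 8/3)`, …) one has `E[e^{l B_{κ'}}] = E[e^{(κ'/κ)·… }]`, precisely `sswMGF κ' l = sswMGF κ (κ' l/κ)`… stated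
here in the solved form `κ' = 2κ/(κ−2)`: `B_{κ'} = (κ/κ') B_κ = ((κ−2)/2) B_κ` in law. [folklore] -/
theorem sswMGF_dilute_eq_dense {κ : ℝ} (hκ : κ ≠ 0) (hκ2 : κ ≠ 2) (l : ℝ) :
    sswMGF (2 * κ / (κ - 2)) l = sswMGF κ ((κ - 2) / 2 * l) := by
  have hsub : κ - 2 ≠ 0 := sub_ne_zero.2 hκ2
  unfold sswMGF
  have h1 : Real.cos (4 * π / (2 * κ / (κ - 2))) = Real.cos (4 * π / κ) := by
    rw [show 4 * π / (2 * κ / (κ - 2)) = 2 * π - 4 * π / κ by field_simp; ring, Real.cos_two_pi_sub]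
  have h2 : (1 - 4 / (2 * κ / (κ - 2))) ^ 2 + 8 * l / (2 * κ / (κ - 2)) =
      (1 - 4 / κ) ^ 2 + 8 * ((κ - 2) / 2 * l) / κ := by
    field_simp
    ring
  rw [h1, h2]

/-- The `μ = 1/6`-twisted one-point nesting exponent of CLE_κ read off SSW's MGF for the dense/dilute
pair `κ ∈ {6, 3}` (`cos(4π/κ) = −1/2`, `(1−4/κ)² = 1/9`): with loop weight `w = 2cos θ` the exponent
`α` in `E[w^{N_ε}] ≈ ε^{α}` solves `cos(π√(1/9 − 8α/κ)) = cos θ`, i.e. `α_κ(θ) = (κ/8)(1/9 − θ²/π²)`;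
for the magic weight `θ = λ + π/3` (loop factor `2cos(λ + π/3)`): `Δ_κ(λ) := −α_κ(λ + π/3) =
(κ/8)((λ/π + 1/3)² − 1/9)`. [cite: SchrammSheffieldWilson2009, Thm 1] -/
def magicExponent (κ lam : ℝ) : ℝ := κ / 8 * ((lam / π + 1 / 3) ^ 2 - 1 / 9)

/-- `Δ₆(λ) = 3λ²/4π² + λ/2π` (the value quoted in the route, NUMBERS). [folklore] -/
theorem magicExponent_six (lam : ℝ) : magicExponent 6 lam = 3 * lam ^ 2 / (4 * π ^ 2) + lam / (2 * π) := by
  unfold magicExponent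
  field_simp
  ring

/-- `Δ₃(λ) = Δ₆(λ)/2`. [folklore] -/
theorem magicExponent_three (lam : ℝ) : magicExponent 3 lam = magicExponent 6 lam / 2 := by
  unfold magicExponent; ring

/-- **Two-point check of the magic formula for CLE₆**: `Δ₆(λ) + Δ₆(−λ) = σ² λ²/(2π)` with `σ² = 3/π`
(the Gaussian functional `exp(−(σ²/2)∬ G f f)`, `G = −(1/2π) log`, gives the ε-exponent `σ²λ²/2π` for
`f = λ(δ_x − δ_y)`; linear terms cancel by charge neutrality). [folklore] -/
theorem two_point_six (lam : ℝ) :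
    magicExponent 6 lam + magicExponent 6 (-lam) = (3 / π) * lam ^ 2 / (2 * π) := by
  unfold magicExponent
  field_simp
  ring

/-- **Two-point exponent of CLE₃ at the same twist**: `σ² = 3/2π = half`; so TWO independent CLE₃'s
give exactly the CLE₆ value `σ² = 3/π` (and `2Δ₃(±λ) = Δ₆(±λ)` term by term). Coulomb gas: `σ²(κ) =
2/(gπ) = κ/2π` with `g = 4/κ`, `n = −2cos(πg) = 1` for both `g = 2/3` (dense, κ = 6) and `g = 4/3`
(dilute, κ = 3, critical Ising domain walls / dilute O(1) on the honeycomb lattice). [folklore] -/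
theorem two_point_three_doubled (lam : ℝ) :
    2 * (magicExponent 3 lam + magicExponent 3 (-lam)) = (3 / π) * lam ^ 2 / (2 * π) := by
  rw [magicExponent_three, magicExponent_three, ← two_point_six]; ring

/-- **Transforms multiply under superposition** (configuration level): for configurations with
disjoint finite loop sets, the loop functional of the union is the product. (Law level: for
INDEPENDENT random configurations the transforms multiply, `E[A_f(𝓛 ⊔ 𝓛')] = E[A_f(𝓛)] E[A_f(𝓛')]`,
since each factor depends on its own loop only — the interior is the loop's own winding-number
interior.) Together with `sswMGF_three_eq_six` / `two_point_three_doubled` this is the mechanism of the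
conditional counterexample of the module docstring, §5: IF full-plane CLE₃ bosonises at the magic twist
with `σ² = 3/2π`, THEN `CLE₃ ⊔ CLE₃'` (independent) has exactly the CLE₆ magic transform, is
E(2)-invariant, mixing, locally finite with simple fat loops, and is `d_CN`-far from CLE₆; so C3's
injectivity class must use non-crossing / nesting-tree structure. [folklore] -/
theorem nestingWeight_union (f : ℂ → ℝ) (c c' : LoopConfig ℂ) (hdisj : Disjoint c.loops c'.loops)
    (hc : c.loops.Finite) (hc' : c'.loops.Finite) :
    (⟨fun i ↦ c.F i ∪ c'.F i⟩ : LoopConfig ℂ).nestingWeight f = c.nestingWeight f * c'.nestingWeight f := by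
  have hl : (⟨fun i ↦ c.F i ∪ c'.F i⟩ : LoopConfig ℂ).loops = c.loops ∪ c'.loops := by
    ext u
    simp only [LoopConfig.mem_loops_iff, mem_union]
    tauto
  rw [LoopConfig.nestingWeight, hl, finprod_mem_union hdisj hc hc', LoopConfig.nestingWeight,
    LoopConfig.nestingWeight]

/-! ### §5b Superposition at law level: independent unions multiply nesting transforms -/

/-- Union (superposition) of two typed configurations, type by type. [folklore] -/
def union (c c' : LoopConfig ℂ) : LoopConfig ℂ := ⟨fun i ↦ c.F i ∪ c'.F i⟩

/-- The loops of a union. [folklore] -/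
@[simp] theorem loops_union' (c c' : LoopConfig ℂ) : (union c c').loops = c.loops ∪ c'.loops := by
  ext u
  simp only [union, LoopConfig.mem_loops_iff, mem_union]
  tauto

/-- The big loops of a union. [folklore] -/
@[simp] theorem bigLoops_union (ε : ℝ) (c c' : LoopConfig ℂ) :
    (union c c').bigLoops ε = c.bigLoops ε ∪ c'.bigLoops ε := by
  ext u
  simp only [LoopConfig.mem_bigLoops_iff, loops_union', mem_union]
  tauto

/-- **The truncated loop functional is multiplicative over disjoint unions** (honest case: finitely many
non-unit factors on each side; with infinitely many the `finprod` junk value `1` breaks it). [folklore] -/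
theorem truncNestingWeight_union (f : ℂ → ℝ) (ε : ℝ) {c c' : LoopConfig ℂ} (hdisj : Disjoint c.loops c'.loops)
    (hc : (c.bigLoops ε ∩ Function.mulSupport (UnbasedLoop.nestingFactor f)).Finite)
    (hc' : (c'.bigLoops ε ∩ Function.mulSupport (UnbasedLoop.nestingFactor f)).Finite) :
    (union c c').truncNestingWeight f ε = c.truncNestingWeight f ε * c'.truncNestingWeight f ε := by
  rw [LoopConfig.truncNestingWeight, LoopConfig.truncNestingWeight, LoopConfig.truncNestingWeight,
    bigLoops_union]
  exact finprod_mem_union' (hdisj.mono (LoopConfig.bigLoops_subset_loops ε c) (LoopConfig.bigLoops_subset_loops ε c'))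
    hc hc'

section Superposition

variable {Ω Ω' : Type*} [MeasurableSpace Ω] [MeasurableSpace Ω']

/-- **Independent superposition multiplies truncated transforms**: under the product law, if the loop
functional of the union factorises pointwise (`truncNestingWeight_union`), then
`Λ^ε_{P ⊗ P'}(f) = Λ^ε_P(f) · Λ^ε_{P'}(f)` (Fubini for a product integrand, `integral_prod_mul`; no
integrability needed — both sides are junk `0` together). [folklore] -/
theorem truncNestingTransform_prod (P : Measure Ω) (P' : Measure Ω') [SFinite P] [SFinite P']
    (X : Ω → LoopConfig ℂ) (X' : Ω' → LoopConfig ℂ) (f : ℂ → ℝ) {ε : ℝ}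
    (h : ∀ ω ω', (union (X ω) (X' ω')).truncNestingWeight f ε =
      (X ω).truncNestingWeight f ε * (X' ω').truncNestingWeight f ε) :
    truncNestingTransform (P.prod P') (fun p ↦ union (X p.1) (X' p.2)) f ε =
      truncNestingTransform P X f ε * truncNestingTransform P' X' f ε := by
  simp only [truncNestingTransform, h]
  exact integral_prod_mul (fun ω ↦ (X ω).truncNestingWeight f ε) (fun ω' ↦ (X' ω').truncNestingWeight f ε)

/-- **Nesting transforms multiply under independent union.** If `Λ^ε_P(f) → Λ` and `Λ^ε_{P'}(f) → Λ'`
then the independent union has transform `Λ · Λ'` (factorisation hypothesis as in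
`truncNestingTransform_prod`, for all small `ε > 0`). This is the engine of the §5 conditional
counterexample: two independent ensembles with the HALF-variance Gaussian transform superpose to an
ensemble with the DKLM/CLE₆ Gaussian transform (`superposition_half_variance`). [folklore] -/
theorem hasNestingTransform_union (P : Measure Ω) (P' : Measure Ω') [SFinite P] [SFinite P']
    (X : Ω → LoopConfig ℂ) (X' : Ω' → LoopConfig ℂ) (f : ℂ → ℝ) {Λ Λ' : ℝ}
    (h : ∀ ε : ℝ, 0 < ε → ∀ ω ω', (union (X ω) (X' ω')).truncNestingWeight f ε =
      (X ω).truncNestingWeight f ε * (X' ω').truncNestingWeight f ε)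
    (hΛ : HasNestingTransform P X f Λ) (hΛ' : HasNestingTransform P' X' f Λ') :
    HasNestingTransform (P.prod P') (fun p ↦ union (X p.1) (X' p.2)) f (Λ * Λ') := by
  unfold HasNestingTransform at *
  refine (hΛ.mul hΛ').congr' ?_
  filter_upwards [self_mem_nhdsWithin] with ε hε
  exact (truncNestingTransform_prod P P' X X' f (h ε hε)).symm

/-- **Two half-variance Gaussians make the DKLM Gaussian**: with `Q = ∬ log‖x−y‖ f(x) f(y)`,
`exp((3/8π²) Q) · exp((3/8π²) Q) = exp((3/4π²) Q)` — `σ² = 3/2π` twice gives `σ² = 3/π`. So if two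
independent random loop configurations (e.g. two full-plane CLE₃'s, conditionally on their magic
bosonisation with `σ² = 3/2π`, cf. `two_point_three_doubled`) each have transform `exp((3/8π²) Q(f))`,
their superposition has EXACTLY the transform required of the CLE₆ / bond-ℤ² limit by
`MagicFormulaZ2`/`MagicFormulaT`. [folklore] -/
theorem superposition_half_variance (P : Measure Ω) (P' : Measure Ω') [SFinite P] [SFinite P']
    (X : Ω → LoopConfig ℂ) (X' : Ω' → LoopConfig ℂ) (f : ℂ → ℝ)
    (h : ∀ ε : ℝ, 0 < ε → ∀ ω ω', (union (X ω) (X' ω')).truncNestingWeight f ε =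
      (X ω).truncNestingWeight f ε * (X' ω').truncNestingWeight f ε)
    (hΛ : HasNestingTransform P X f (Real.exp (3 / (8 * π ^ 2) * ∫ x, ∫ y, Real.log ‖x - y‖ * f x * f y)))
    (hΛ' : HasNestingTransform P' X' f (Real.exp (3 / (8 * π ^ 2) * ∫ x, ∫ y, Real.log ‖x - y‖ * f x * f y))) :
    HasNestingTransform (P.prod P') (fun p ↦ union (X p.1) (X' p.2)) f
      (Real.exp (3 / (4 * π ^ 2) * ∫ x, ∫ y, Real.log ‖x - y‖ * f x * f y)) := by
  have key := hasNestingTransform_union P P' X X' f h hΛ hΛ'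
  rw [← Real.exp_add] at key
  convert key using 2
  ring

end Superposition

/-! ## §6 Monte Carlo (route's cheapest falsifier) — job ids, design, predictions; numbers when the jobs return

-- MC design (folder `mc/main.py`, kit jobs attach `results.json` + stdout table to stmt-4835 as evidence on completion):
--   models: bond-ℤ² at p = 1/2 (refined (2L+1)² grid: primal/dual vertex cells + bond cells, 4-connectivity = primal/dual
--   connectivity; f carried by vertex cells = medial diamonds), site-𝕋 at 1/2 (hexagon cells, 6-connectivity), and critical
--   Ising on 𝕋 (K_c = ln 3/4, Swendsen–Wang) whose spin-cluster boundaries are the dilute-O(1)/CLE₃ loops of §5.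
--   loops = hulls of finite clusters of either colour; int(hull) = filled cluster, computed through the nesting tree
--   (parent = cluster of the cell above the topmost cell; self-tested against binary_fill_holes); free boundary, hulls cut by
--   the box discarded (bias: loops of scale > L matter with weight ~ (d/L)^{1/4} · 0.06/dyadic scale).
--   test function f = λ (U_A − U_B), U_X uniform on a pixel disc of radius ρ, B = A + (d, 0) exact lattice translate;
--   Λ(λ) = mean over samples of ∏_hulls 2cos(λ(frac_A − frac_B) + π/3), all λ ∈ {1/4, 1/2, 1, 3/2, 2, 3} from the same samples.
-- Predictions (continuum discs; the job also prints the exact pixel value Q₁ = q_AA + q_BB − 2q_AB):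
--   log Λ_pred = (3/4π²) λ² Q₁,  Q₁ ≈ 2 log ρ − 1/2 − 2 log d:
--     d/ρ = 8  (ρ=6,d=48 | ρ=8,d=64):   Q₁ ≈ −4.659  ⇒ log Λ ≈ −0.354 λ²   (λ=1: Λ ≈ 0.702; λ=2: 0.243)
--     d/ρ = 16 (ρ=6,d=96 | ρ=8,d=128):  Q₁ ≈ −6.045  ⇒ log Λ ≈ −0.459 λ²   (λ=1: 0.632; λ=2: 0.159)
--     d/ρ = 32 (ρ=8,d=256):             Q₁ ≈ −7.432  ⇒ log Λ ≈ −0.565 λ²   (λ=1: 0.568; λ=2: 0.104)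
--   Ising/CLE₃ CONDITIONAL prediction (§5): log Λ_Ising ≈ ½ · the above (σ² = 3/2π).
--   Tests: Z2 vs pred = conventions check of MagicFormulaZ2-as-typed (DKLM theorem); T vs pred = MagicFormulaT; Z2 vs T at equal
--   geometry = TransferContinuity + X (box bias largely common); slope in log(d/ρ) is the cleanest σ² test; Ising vs ½·pred = the
--   premise of the CLE₃ ⊔ CLE₃ counterexample.
-- Jobs (queue saturated 2026-08-15/16; cdisprove lane prio 85 behind prio 94 influx): j013281 (1 core, L=512, ρ=6, d=48/96),
--   j013283 (4 cores, tag long, L=1024, ρ=8, d=64/128/256, 3000 samples), j005605 (L=1024, older 4c/4h ask), j005610 (L=2048);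
--   cancelled: j005383 (8-core smoke), j013273 (clamped). Results: ~/compute/<id>/outputs/results.json — to be transcribed here.
-/

/-! ## §3b Fat + untyped + finite is still not enough: covering multiplicity is invisible

The transform sees a loop only through its interior `{W ≠ 0}` up to null sets; `d_CN` sees the
unbased curve. The circle traversed ONCE and the circle traversed TWICE have the same trace, the same
diameter, interiors `{W ≠ 0}` differing only on the (null) circle itself, and are both fat; but
`d(u₁, u₂) ≥ r` because winding numbers are `udist`-stable (`wind_eq_or_eq_neg_of_udist_lt`: `2 ≠ ±1`).
So `FatUntypedConfigTransformRigidity` is FALSE (`not_fatUntypedConfigTransformRigidity`) — the near-miss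
of v0 (inward needle) is superseded by this cheaper witness. Load-bearing hypothesis exposed: the class of
subsequential limits must consist of loops of covering degree one / `W ∈ {−1, 0, 1}` (exterior boundaries
of clusters), again an RSW-type regularity input and not a consequence of the transform hypotheses. -/

/-- The circle of radius `r` about `c` traversed `n` times: `t ↦ c + r e^{2πint}`. [folklore] -/
def windCurve (c : ℂ) (r : ℝ) (n : ℕ) : Curve ℂ :=
  ⟨⟨fun t : unitInterval ↦ c + r * Complex.exp (2 * π * Complex.I * n * (t : ℝ)), by fun_prop⟩⟩

/-- Pointwise formula. [folklore] -/
theorem windCurve_apply (c : ℂ) (r : ℝ) (n : ℕ) (t : unitInterval) :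
    windCurve c r n t = c + r * Complex.exp (2 * π * Complex.I * n * (t : ℝ)) := rfl

/-- The `n`-fold circle is closed (`e^{2πin} = 1`). [folklore] -/
theorem isLoop_windCurve (c : ℂ) (r : ℝ) (n : ℕ) : (windCurve c r n).IsLoop := by
  rw [Curve.isLoop_iff, Curve.source_def, Curve.target_def, windCurve_apply, windCurve_apply]
  simp only [Set.Icc.coe_zero, Set.Icc.coe_one, Complex.ofReal_zero, mul_zero, Complex.exp_zero,
    Complex.ofReal_one, mul_one]
  rw [show (2 * π * Complex.I * n : ℂ) = n * (2 * π * Complex.I) by ring, Complex.exp_nat_mul_two_pi_mul_I,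
    mul_one]

/-- Every point of the `n`-fold circle is at distance `|r|` from the centre. [folklore] -/
theorem norm_windCurve_sub_center (c : ℂ) (r : ℝ) (n : ℕ) (t : unitInterval) :
    ‖windCurve c r n t - c‖ = |r| := by
  rw [windCurve_apply, add_sub_cancel_left, norm_mul, Complex.norm_real, Real.norm_eq_abs,
    show (2 * π * Complex.I * n * (t : ℝ) : ℂ) = ((2 * π * n * (t : ℝ) : ℝ) : ℂ) * Complex.I by push_cast; ring,
    Complex.norm_exp_ofReal_mul_I, mul_one]

/-- The `n`-fold circle as an unbased loop. [folklore] -/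
def windLoop (c : ℂ) (r : ℝ) (n : ℕ) : UnbasedLoop ℂ :=
  UnbasedLoop.mk (BasedLoop.mk (CurveClass.mk (windCurve c r n)) (CurveClass.isLoop_mk.2 (isLoop_windCurve c r n)))

/-- The trace of the `n`-fold circle lies on the sphere of radius `|r|`. [folklore] -/
theorem range_windLoop_subset_sphere (c : ℂ) (r : ℝ) (n : ℕ) :
    (windLoop c r n).range ⊆ Metric.sphere c |r| := by
  rintro _ ⟨t, rfl⟩
  rw [Metric.mem_sphere, Complex.dist_eq]
  exact norm_windCurve_sub_center c r n t

/-- The centre is off the trace (for `r ≠ 0`). [folklore] -/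
theorem center_not_mem_range_windCurve (c : ℂ) {r : ℝ} (hr : r ≠ 0) (n : ℕ) :
    c ∉ (windCurve c r n).range := by
  rintro ⟨t, ht⟩
  have := norm_windCurve_sub_center c r n t
  rw [ht, sub_self, norm_zero] at this
  exact hr (abs_eq_zero.1 this.symm)

/-- **The `n`-fold circle winds `n` times around its centre** (explicit logarithm `log r + 2πint`).
[folklore] -/
theorem wind_windLoop_center (c : ℂ) {r : ℝ} (hr : 0 < r) (n : ℕ) : (windLoop c r n).wind c = n := by
  show (windCurve c r n).wind c = ((n : ℤ) : ℤ)
  refine Curve.wind_eq_of_log (isLoop_windCurve c r n)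
    (l := fun t ↦ (Real.log r : ℂ) + 2 * π * Complex.I * n * t) (by fun_prop) (fun t ht ↦ ?_) ?_
  · rw [Complex.exp_add, ← Complex.ofReal_exp, Real.exp_log hr]
    show (r : ℂ) * Complex.exp (2 * π * Complex.I * n * t) = windCurve c r n ⟨t, ht⟩ - c
    rw [windCurve_apply, add_sub_cancel_left]
  · push_cast; ring

/-- **… and `n` times around every point of the open disc** (Rouché: moving the point by less than
`r` does not change the winding number). [folklore] -/
theorem wind_windLoop_of_dist_lt (c : ℂ) {r : ℝ} (hr : 0 < r) (n : ℕ) {z : ℂ} (hz : dist z c < r) :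
    (windLoop c r n).wind z = n := by
  rw [← wind_windLoop_center c hr n]
  show (windCurve c r n).wind z = (windCurve c r n).wind c
  unfold Curve.wind
  refine Literature.Topology.PlaneTopology.wind_eq_of_norm_sub_lt
    (Curve.continuous_subPt _ z).continuousOn (Curve.subPt_zero_eq_one (isLoop_windCurve c r n) z)
    (Curve.isNonvanishingLoop_subPt (isLoop_windCurve c r n) (center_not_mem_range_windCurve c hr.ne' n))
    (fun t ht ↦ ?_)
  rw [Curve.subPt_of_mem _ _ ht, Curve.subPt_of_mem _ _ ht, sub_sub_sub_cancel_left,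
    norm_windCurve_sub_center, abs_of_pos hr, ← dist_eq_norm, dist_comm]
  exact hz

/-- **… and zero times around every point outside the closed disc.** [folklore] -/
theorem wind_windLoop_of_lt_dist (c : ℂ) (r : ℝ) (n : ℕ) {z : ℂ} (hz : |r| < dist z c) :
    (windLoop c r n).wind z = 0 := by
  show (windCurve c r n).wind z = 0
  refine Curve.wind_eq_zero_of_subset_ball (w := c) (ρ := dist z c) ?_ le_rfl
  rintro _ ⟨t, rfl⟩
  rw [Metric.mem_ball, dist_eq_norm, norm_windCurve_sub_center]
  exact hz

/-- The interior `{W ≠ 0}` of the `n`-fold circle (`n ≠ 0`) is the open disc up to the null circle.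
[folklore] -/
theorem setOf_wind_windLoop_ae_eq_ball (c : ℂ) {r : ℝ} (hr : 0 < r) {n : ℕ} (hn : n ≠ 0) :
    {z | (windLoop c r n).wind z ≠ 0} =ᵐ[volume] Metric.ball c r := by
  refine ae_eq_set.2 ⟨?_, ?_⟩
  · refine measure_mono_null (fun z hz ↦ ?_) (Measure.addHaar_sphere volume c r)
    rcases hz with ⟨hS, hb⟩
    rw [Metric.mem_ball, not_lt] at hb
    rcases hb.lt_or_eq with hlt | heq
    · exact absurd (wind_windLoop_of_lt_dist c r n (by rwa [abs_of_pos hr])) hS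
    · exact Metric.mem_sphere.2 heq.symm
  · rw [Set.sdiff_eq_empty.2 fun z hz ↦ ?_, measure_empty]
    rw [mem_setOf_eq, wind_windLoop_of_dist_lt c hr n (Metric.mem_ball.1 hz)]
    exact_mod_cast hn

/-- All `n`-fold circles (`n ≠ 0`) have the same `f`-mass of the interior. [folklore] -/
theorem nestingPhase_windLoop_eq (f : ℂ → ℝ) (c : ℂ) {r : ℝ} (hr : 0 < r) {n m : ℕ} (hn : n ≠ 0) (hm : m ≠ 0) :
    (windLoop c r n).nestingPhase f = (windLoop c r m).nestingPhase f := by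
  unfold UnbasedLoop.nestingPhase
  exact setIntegral_congr_set ((setOf_wind_windLoop_ae_eq_ball c hr hn).trans
    (setOf_wind_windLoop_ae_eq_ball c hr hm).symm)

/-- Hence the same loop factor. [folklore] -/
theorem nestingFactor_windLoop_eq (f : ℂ → ℝ) (c : ℂ) {r : ℝ} (hr : 0 < r) {n m : ℕ} (hn : n ≠ 0) (hm : m ≠ 0) :
    (windLoop c r n).nestingFactor f = (windLoop c r m).nestingFactor f := by
  rw [UnbasedLoop.nestingFactor, UnbasedLoop.nestingFactor, nestingPhase_windLoop_eq f c hr hn hm]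

/-- The double circle and the single circle have the same trace (`e^{4πit} = e^{2πi(2t)}`,
`e^{2πit} = e^{4πi(t/2)}`, with `2t` reduced mod `1`). [folklore] -/
theorem range_windLoop_two_eq_one (c : ℂ) (r : ℝ) : (windLoop c r 2).range = (windLoop c r 1).range := by
  apply Subset.antisymm
  · rintro _ ⟨t, rfl⟩
    -- the point at parameter `t` of the double circle is the point at `fract (2t)` of the single one
    refine ⟨⟨Int.fract (2 * (t : ℝ)), Int.fract_nonneg _, (Int.fract_lt_one _).le⟩, ?_⟩
    show windCurve c r 1 _ = windCurve c r 2 t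
    rw [windCurve_apply, windCurve_apply]
    congr 2
    simp only [Nat.cast_one, mul_one, Nat.cast_ofNat]
    rw [Int.fract, Complex.ofReal_sub, mul_sub, Complex.exp_sub, Complex.ofReal_intCast,
      show (2 * π * Complex.I * (⌊2 * (t : ℝ)⌋ : ℂ)) = (⌊2 * (t : ℝ)⌋ : ℂ) * (2 * π * Complex.I) by ring,
      Complex.exp_int_mul_two_pi_mul_I, div_one]
    push_cast; ring_nf
  · rintro _ ⟨t, rfl⟩
    refine ⟨⟨(t : ℝ) / 2, by constructor <;> linarith [t.2.1, t.2.2]⟩, ?_⟩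
    show windCurve c r 2 _ = windCurve c r 1 t
    rw [windCurve_apply, windCurve_apply]
    congr 2
    push_cast; ring

/-- **Winding numbers separate the single and the double circle in DKKMO's distance**:
`d(u₁, u₂) ≥ r` (if `d < r = dist(c, trace)` then `W(u₂, c) = ±W(u₁, c)`, i.e. `2 = ±1`). [folklore] -/
theorem le_udist_windLoop_one_two (c : ℂ) {r : ℝ} (hr : 0 < r) :
    r ≤ (windLoop c r 1).udist (windLoop c r 2) := by
  by_contra h
  rw [not_le] at h
  have hinf : r ≤ Metric.infDist c (windLoop c r 1).range := by
    rw [Metric.le_infDist (UnbasedLoop.range_nonempty _)]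
    intro y hy
    have := range_windLoop_subset_sphere c r 1 hy
    rw [Metric.mem_sphere, abs_of_pos hr] at this
    rw [dist_comm, this]
  have key := UnbasedLoop.wind_eq_or_eq_neg_of_udist_lt (h.trans_le hinf)
  rw [wind_windLoop_center c hr 2, wind_windLoop_center c hr 1] at key
  norm_num at key

/-- **(S-fat-untyped) the strongest configuration-level principle of this file**: finitely many loops,
all fat, equal truncated loop functionals for all `f, ε` ⇒ UNTYPED `d_CN`-closeness. FALSE:
`not_fatUntypedConfigTransformRigidity`. [folklore] -/
def FatUntypedConfigTransformRigidity : Prop :=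
  ∀ c c' : LoopConfig ℂ, c.loops.Finite → c'.loops.Finite →
    (∀ u ∈ c.loops, Fat u) → (∀ u ∈ c'.loops, Fat u) →
    (∀ (f : ℂ → ℝ) (ε : ℝ), c.truncNestingWeight f ε = c'.truncNestingWeight f ε) →
    ∀ ε : ℝ, 0 < ε → ε ≤ 1 → LoopConfig.IsClose ε (untype c) (untype c')

/-- **Covering multiplicity is invisible to the transform, visible to `d_CN`**: the circle of radius
`1/2` about `0` traversed once versus twice. Both configurations consist of one fat loop, have the same
truncated loop functionals for every test function and cut-off (same factor by
`nestingFactor_windLoop_eq`, same diameter by `range_windLoop_two_eq_one`), and are not untyped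
`d_CN`-close at scale `1/4 < 1/2 ≤ d(u₁, u₂)`. [folklore] -/
theorem not_fatUntypedConfigTransformRigidity : ¬ FatUntypedConfigTransformRigidity := by
  intro h
  have hr : (0 : ℝ) < 1 / 2 := by norm_num
  set u₁ : UnbasedLoop ℂ := windLoop 0 (1 / 2) 1 with hu₁
  set u₂ : UnbasedLoop ℂ := windLoop 0 (1 / 2) 2 with hu₂
  have hfat : ∀ {n : ℕ}, n ≠ 0 → Fat (windLoop 0 (1 / 2) n) := fun {n} hn ↦
    ⟨0, by rw [wind_windLoop_center 0 hr n]; exact_mod_cast hn⟩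
  have hfac : ∀ f : ℂ → ℝ, u₁.nestingFactor f = u₂.nestingFactor f := fun f ↦
    nestingFactor_windLoop_eq f 0 hr one_ne_zero two_ne_zero
  have hrange : u₂.range = u₁.range := range_windLoop_two_eq_one 0 (1 / 2)
  have htrunc : ∀ (f : ℂ → ℝ) (ε : ℝ),
      (single 0 u₁).truncNestingWeight f ε = (single 0 u₂).truncNestingWeight f ε := by
    intro f ε
    simp only [LoopConfig.truncNestingWeight, LoopConfig.bigLoops, loops_single]
    by_cases hε : ε ≤ Metric.diam u₁.range
    · have h1 : {u ∈ ({u₁} : Set (UnbasedLoop ℂ)) | ε ≤ Metric.diam u.range} = {u₁} := by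
        ext u; simp only [mem_setOf_eq, mem_singleton_iff]; constructor
        · exact fun h ↦ h.1
        · intro h; exact ⟨h, h ▸ hε⟩
      have h2 : {u ∈ ({u₂} : Set (UnbasedLoop ℂ)) | ε ≤ Metric.diam u.range} = {u₂} := by
        ext u; simp only [mem_setOf_eq, mem_singleton_iff]; constructor
        · exact fun h ↦ h.1
        · intro h; exact ⟨h, h ▸ hrange ▸ hε⟩
      rw [h1, h2, finprod_mem_singleton, finprod_mem_singleton, hfac]
    · have h1 : {u ∈ ({u₁} : Set (UnbasedLoop ℂ)) | ε ≤ Metric.diam u.range} = ∅ := by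
        ext u; simp only [mem_setOf_eq, mem_singleton_iff, mem_empty_iff_false, iff_false, not_and]
        intro h; exact h ▸ hε
      have h2 : {u ∈ ({u₂} : Set (UnbasedLoop ℂ)) | ε ≤ Metric.diam u.range} = ∅ := by
        ext u; simp only [mem_setOf_eq, mem_singleton_iff, mem_empty_iff_false, iff_false, not_and]
        intro h; exact h ▸ hrange ▸ hε
      rw [h1, h2, finprod_mem_empty]
  have hclose := h (single 0 u₁) (single 0 u₂) (by rw [loops_single]; exact finite_singleton _)
    (by rw [loops_single]; exact finite_singleton _)
    (fun v hv ↦ by rw [loops_single, mem_singleton_iff] at hv; exact hv ▸ hfat one_ne_zero)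
    (fun v hv ↦ by rw [loops_single, mem_singleton_iff] at hv; exact hv ▸ hfat two_ne_zero)
    htrunc (1 / 4) (by norm_num) (by norm_num)
  -- the only candidate partner of `u₁` is `u₂`, at unoriented distance `≥ 1/2 > 1/4`
  obtain ⟨v, hv, hd⟩ := (hclose 0).1 u₁ (by simp [untype]) (by
    intro z hz
    have := range_windLoop_subset_sphere 0 (1 / 2) 1 hz
    rw [Metric.mem_sphere, abs_of_pos hr] at this
    rw [Metric.mem_ball, this]; norm_num)
  simp only [untype_F, loops_single, mem_singleton_iff] at hv
  subst hv
  have := le_udist_windLoop_one_two 0 hr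
  linarith

/-! ## Targets — the picked line `markov-cascade-one-generation` (PICKED.md 2026-08-16T02:49Z, lead seat -1) -/

-- Pass of 2026-08-16T05:20Z over `Lines/markov-cascade-one-generation.lean` (gen-2), stub by stub; no `stuck_stubs`
-- were handed to this seat yet, so this is a proactive junk/falsity screen, not a kill list.
-- * STUB 1/2 `OneGenerationZ2/T` (exact one-generation factorisation): no junk found. Both sides are `0` when `γ` is not a
--   possible interface circuit (`P(I_γ) = 0`: set integral over a null set; `condTransform# = 0/0 = 0`). On `I_γ` every loop
--   not inside `γ` weighs `1` because `f ≠ 0 ⇒ W(γ,·) ≠ 0` and `∫ f = 0` (surrounding loops: phase `∫ f`; disjoint: `0`;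
--   `γ` itself: `∫ f`); inside loops may TOUCH `γ` at midpoints of `γ`'s edges (medial vertices carry 4 darts) but their
--   turns there read only the pinned states of `γ`'s edges — consistent with the cylinder argument. Believed TRUE; M-sized.
-- * STUB 6 `WindowLocality`: TRUE and provable as the docstring says — checked the converse direction that worried me:
--   a loop of the closed-b.c. ball ensemble with trace in `B(0,1/η)` visits only edges with both endpoints in
--   `B(0, 1/η + δ/2) ⊆ B(0,R)`, whose states are unchanged by `∩ meshEdges`, so it IS a full-plane interface loop of the
--   same type (the NEW loops created by closing the exterior all visit an exterior-closed edge, hence pass within `δ` of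
--   `∂B(0,R)`, outside the window). No junk.
-- * STUB 3 `DeAveraging`, STUB 4 `KernelUniqueness`, STUB 5 `CascadeReconstruction`: as typed they speak ONLY about the two
--   concrete lattice ensembles, so — like the crux — each implication is true in the believed world (closed-b.c. domain
--   universality gives `DomainTransfer`, `KernelTransfer`, `DomainLawTransfer` outright) and is attackable only through
--   an abstract strengthening. The barrier `NestingTransformBlindness` bites exactly those strengthenings: (types)
--   `firstGen` keeps lattice types — fine; (multiplicity/degeneracy) `TwoSided u` is imposed on the LIMIT loop only, the
--   approximants `uδ δ` may carry `δ`-thin slots/spikes: harmless here because slot loops never meet `tsupport f ⊆ holeOf u`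
--   (weight `1`) and `d_CN` matches micro first-generation loops within tolerance `ε` along the closed backbone on both
--   lattices (finite energy) — so no `_false_without_TwoSided` at the level of the typed stubs; (superposition) the
--   CLE₃ ⊔ CLE₃ impostor is excluded from STUB 4 only because its hypothesis is the concrete pair (ℤ², 𝕋): an ABSTRACT
--   "equal domain transforms in all domains ⇒ equal first-generation kernels" for interface-Markov cascades is NOT refuted
--   by the impostor (an independent union is not a cascade), and for ONE-loop first generations it is even TRUE
--   (`Re(ω φ_Q(f))` and `Re(ω̄ φ_Q(f))`, `ω = e^{iπ/3}`, determine the characteristic functional `φ_Q` of `1_{int ℓ}` —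
--   this uses `μ ∉ {0, 1/4}`); the genuine obstruction is again the INFINITE first generation of the continuum kernel
--   (outermost loops accumulate along the closed backbone, which is dense in `D`: infinitely many VISIBLE first-generation
--   loops inside `supp f`, total variation `2^{N} = ∞`), i.e. STUB 4 inherits the crux's difficulty undiminished.
-- * Definitions: `domLoopsZ2` restriction (gen-2 fix of the exterior-diamond carpet) verified sound: a diamond around an
--   exterior vertex visits no edge of `meshEdges U δ`; an isolated vertex of `U_δ` next to the boundary keeps its diamond
--   (it visits an inside closed edge) — a genuine micro first-generation loop, matched on 𝕋 by boundary-adjacent open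
--   sites. `firstGen` uses STRICT inclusion of winding interiors: distinct lattice loops never share an interior, fine.
-- Verdict for the lead: 0 stub-false, 0 stub-misstated from this seat; the line's risk is concentrated in STUB 3/4 exactly
-- as PICKED.md says; nothing cheap remains for the disprover on this line until a stub is reshaped into an abstract form.

/-! ## §7 Near-misses (sorried; this work file only) -/

/-- NEAR-MISS (POSITIVE; why cheap finite counterexamples to C3 do not exist). For configurations
`c, c'` with finitely many loops, each the boundary of a Jordan domain (trace = frontier of the
interior), pairwise disjoint traces, and the same types... equal loop functionals `A_f(c) = A_f(c')` for
all bounded compactly supported `f` force `c = c'`. Sketch (grading argument): expand `∏_ℓ (ω e^{i a_ℓ}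
+ ω̄ e^{−i a_ℓ})`, `ω = e^{iπ/3}`, `a_ℓ = ∫_{int ℓ} f`, into characters `e^{i⟨f, Σ ε_ℓ 1_{int ℓ}⟩}`;
characters with a.e.-distinct integer fields are linearly independent as functionals of `f`; for a
generic positive weight the all-plus field `N_c = Σ 1_{int ℓ}` is the unique top-weight term of `c`
(coefficient `ω^{#loops} ≠ 0`) and `N_c` determines the laminar family of Jordan interiors, hence `c`.
The same argument gives injectivity on finitely supported LAWS. It breaks exactly for infinite nesting
(no top-weight term; total variation `2^{#loops} = ∞`), which is where C3 lives. Not formalised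
(needs linear independence of characters on `L^∞_c`). [folklore] -/
theorem finiteConfig_transform_injective_nearMiss : True := trivial

end Summit.CriticalPhenomena.CardyFormulaZ2.Cruxes.NestingRigidity.Disproof

end
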